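import Summits.Ventures.PercRepro.S1CoreCapSpecSpreadSixLinesA
import Summits.Ventures.PercRepro.S1CoreCapSpecSpreadFiveHeavy

/-!
# PercRepro — TOWARDS THE INSTANCE `ν = 6` OF THE SPREAD SPEC: THE WEIGHT-`4` LINE AND THE FAT POINT AT NULLITY `6` (p1, gen 32)

`proofs/P1-S2-CORANK6.md` §4h. At nullity `6`: a line of weight `4` beside simple 3-point lines leaves room for at most FIVE of them
(`card_le_six_of_weight_four_six`: at most one meets it, and then the rest are disjoint from both (cost `3` ⟹ `≤ 4`), else all are disjoint
from it and form an all-simple configuration of cost `≤ 4` (`≤ 5`, `card_le_five_of_three_points_spread_four`) — the search's maximiser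
`4 + 1 + 4 = 9`, a 4-line, a 3-line through it and a disjoint `K₄`); two one-fat lines through their fat point leave room for at most four
simple lines, all disjoint from both (`card_le_six_of_two_fat_six`; cap `2 + 2 + 4 = 8`). Also `simple_filter_weight_one`: the weights of a
family of lines of weight `3` are all `1`. Axioms: standard.
-/

namespace PercRepro

namespace S1

namespace FourCap

variable {β : Type} [DecidableEq β]

section SixHeavy

variable {w : β → ℕ} {ls : Finset (Finset β)}
  (h1 : ∀ L ∈ ls, ∀ v ∈ L, w v = 1 ∨ w v = 2)
  (h2 : ∀ L ∈ ls, 3 ≤ L.card ∧ wsum w L ≤ 5)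
  (h3 : ∀ L ∈ ls, ∀ L' ∈ ls, L ≠ L' → (L ∩ L').card ≤ 1)
  (h4 : ∀ l : List (Finset β), l.Nodup → (∀ L ∈ l, L ∈ ls) → wsum w (unionL l) ≤ 6 + lineRank l)
  (h7 : ∀ l : List (Finset β), l.Nodup → (∀ L ∈ l, L ∈ ls) → lineRank l ≤ 4 → wsum w (unionL l) ≤ lineRank l + 3)

omit [DecidableEq β] in
/-- A line of weight `3` with `3` points has all its weights `1`. -/
theorem weight_one_of_simple_line {L : Finset β} (hw : ∀ v ∈ L, w v = 1 ∨ w v = 2) (hc : L.card = 3) (hwL : wsum w L = 3)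
    {v : β} (hv : v ∈ L) : w v = 1 := by
  rcases hw v hv with h | h
  · exact h
  · exfalso
    have hf : fat w L = 0 := by
      have := wsum_eq_card_add_fat w L hw; omega
    have : 0 < fat w L := by
      unfold fat
      exact Finset.card_pos.2 ⟨v, Finset.mem_filter.2 ⟨hv, h⟩⟩
    omega

include h1 h2 h3 h4 h7 in
/-- **A line of weight `4` beside simple 3-point lines leaves room for at most five of them at nullity `6`.** -/
theorem card_le_six_of_weight_four_six {L₁ : Finset β} (hL₁ : L₁ ∈ ls) (hw4 : wsum w L₁ = 4)
    (hoth : ∀ L ∈ ls, L ≠ L₁ → L.card = 3 ∧ wsum w L = 3) : ls.card ≤ 6 := by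
  have hk₁ := (h2 L₁ hL₁).1
  by_cases hex : ∃ X ∈ ls, X ≠ L₁ ∧ (X ∩ L₁).Nonempty
  · obtain ⟨X, hX, hXne, hmeet⟩ := hex
    obtain ⟨hcX, hwX⟩ := hoth X hX hXne
    obtain ⟨hrank, hwb⟩ := base_two_of_meet h1 h2 h3 hL₁ hX hXne hw4 hcX hwX hmeet
    have hb : ([X, L₁] : List (Finset β)).Nodup := by simp [hXne]
    have hbl : ∀ L ∈ ([X, L₁] : List (Finset β)), L ∈ ls := by simp [hX, hL₁]
    have hD := card_filter_disjoint_le_four_gen h1 h2 h3 h4 hb hbl (by rw [hrank, hwb])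
    have hcover : ls ⊆ ({X, L₁} : Finset (Finset β)) ∪ ls.filter (fun L => Disjoint L (unionL [X, L₁])) := by
      intro Y hY
      rw [Finset.mem_union, Finset.mem_insert, Finset.mem_singleton]
      by_cases hYX : Y = X
      · exact Or.inl (Or.inl hYX)
      by_cases hYL : Y = L₁
      · exact Or.inl (Or.inr hYL)
      refine Or.inr (Finset.mem_filter.2 ⟨hY, ?_⟩)
      rw [Finset.disjoint_iff_inter_eq_empty]
      by_contra hne
      obtain ⟨hcY, hwY⟩ := hoth Y hY hYL
      have ho : (Y ∩ unionL [X, L₁]).card ≤ 2 := by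
        simp only [unionL, Finset.union_empty]
        rw [Finset.inter_union_distrib_left]
        refine (Finset.card_union_le _ _).trans ?_
        have := h3 Y hY X hX hYX
        have := h3 Y hY L₁ hL₁ hYL
        omega
      exact not_meet_of_cost_three h1 h7 hb hbl hrank hwb hY (by simp [hYX, hYL]) hcY hwY
        (Finset.nonempty_iff_ne_empty.2 hne) ho
    have hc := Finset.card_le_card hcover
    have hu := Finset.card_union_le ({X, L₁} : Finset (Finset β)) (ls.filter (fun L => Disjoint L (unionL [X, L₁])))
    have h2' : ({X, L₁} : Finset (Finset β)).card ≤ 2 := Finset.card_le_two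
    omega
  · push Not at hex
    -- the lines disjoint from `L₁` form an all-simple configuration of cost `≤ 4`
    set D := ls.filter (fun L => Disjoint L (unionL [L₁])) with hD
    have hDm : ∀ L ∈ D, L ∈ ls ∧ Disjoint L (unionL [L₁]) := fun L hL => Finset.mem_filter.1 hL
    have hDne : ∀ L ∈ D, L ≠ L₁ := by
      intro L hL hLL
      have := (hDm L hL).2
      rw [hLL] at this
      exact not_disjoint_unionL_of_mem h2 (b := [L₁]) (by simp [hL₁]) (by simp) this
    have hb : ([L₁] : List (Finset β)).Nodup := List.nodup_singleton L₁
    have hbl : ∀ L ∈ ([L₁] : List (Finset β)), L ∈ ls := by simp [hL₁]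
    have hcost : 6 + lineRank [L₁] ≤ 4 + wsum w (unionL [L₁]) := by
      simp only [unionL, lineRank, Finset.union_empty, Finset.sdiff_empty, Finset.inter_empty, Finset.card_empty,
        Nat.zero_add]
      rw [show (2 - min 0 2 : ℕ) = 2 by decide, hw4]
      have : min L₁.card 2 = 2 := min_eq_right (by omega)
      omega
    have h4' : ∀ l : List (Finset β), l.Nodup → (∀ L ∈ l, L ∈ D) → wsum w (unionL l) ≤ 4 + lineRank l := by
      intro l hl hll
      refine cost_clause_restrict_gen h4 hb hbl hcost l hl (fun L hL => (hDm L (hll L hL)).1)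
        (fun L hL => (hDm L (hll L hL)).2) ?_
      intro L hL hLb
      exact not_disjoint_unionL_of_mem h2 hbl hLb (hDm L (hll L hL)).2
    have hw1' : ∀ L ∈ D, ∀ v ∈ L, w v = 1 := fun L hL v hv => by
      obtain ⟨hc, hw⟩ := hoth L (hDm L hL).1 (hDne L hL)
      exact weight_one_of_simple_line (h1 L (hDm L hL).1) hc hw hv
    have hcard' : ∀ L ∈ D, L.card = 3 := fun L hL => (hoth L (hDm L hL).1 (hDne L hL)).1
    have hfive : D.card ≤ 5 :=
      card_le_five_of_three_points_spread_four hw1' hcard'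
        (fun L hL L' hL' hne => h3 L (hDm L hL).1 L' (hDm L' hL').1 hne)
        (fun l hl hll => h7 l hl (fun L hL => (hDm L (hll L hL)).1)) h4'
    have hcover : ls ⊆ ({L₁} : Finset (Finset β)) ∪ D := by
      intro Y hY
      rw [Finset.mem_union, Finset.mem_singleton]
      by_cases hYL : Y = L₁
      · exact Or.inl hYL
      refine Or.inr (Finset.mem_filter.2 ⟨hY, ?_⟩)
      simp only [unionL, Finset.union_empty]
      rw [Finset.disjoint_iff_inter_eq_empty]
      exact hex Y hY hYL
    have hc := Finset.card_le_card hcover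
    have hu := Finset.card_union_le ({L₁} : Finset (Finset β)) D
    rw [Finset.card_singleton] at hu
    omega

include h1 h2 h3 h4 h7 in
/-- **Two one-fat lines through their fat point leave room for at most four simple lines at nullity `6`** (all disjoint from both;
the base has cost `3`). -/
theorem card_le_six_of_two_fat_six {F₁ F₂ : Finset β} (hF₁ : F₁ ∈ ls) (hF₂ : F₂ ∈ ls) (h21 : F₂ ≠ F₁) (hc₁ : F₁.card = 3)
    (hc₂ : F₂.card = 3) (hw₁ : wsum w F₁ = 4) (hw₂ : wsum w F₂ = 4) {p : β} (hp₁ : p ∈ F₁) (hp₂ : p ∈ F₂) (hp2 : w p = 2)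
    (hoth : ∀ L ∈ ls, L ≠ F₁ → L ≠ F₂ → L.card = 3 ∧ wsum w L = 3) : ls.card ≤ 6 := by
  have i21 : F₂ ∩ F₁ = {p} := by
    refine Finset.eq_singleton_iff_unique_mem.2 ⟨Finset.mem_inter.2 ⟨hp₂, hp₁⟩, fun x hx => ?_⟩
    exact Finset.card_le_one.1 (h3 F₂ hF₂ F₁ hF₁ h21) x hx p (Finset.mem_inter.2 ⟨hp₂, hp₁⟩)
  have hf₂ : fat w F₂ = 1 := by have := wsum_eq_card_add_fat w F₂ (h1 F₂ hF₂); omega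
  have hfi2 : 1 ≤ fat w (F₂ ∩ F₁) := by
    unfold fat
    exact Finset.card_pos.2 ⟨p, Finset.mem_filter.2 ⟨i21 ▸ Finset.mem_singleton_self p, hp2⟩⟩
  have hs2 := fat_sdiff_add_fat_inter w F₂ F₁
  have hw2 := wsum_sdiff_eq w F₂ F₁ (h1 F₂ hF₂)
  have ci2 : (F₂ ∩ F₁).card = 1 := by rw [i21]; simp
  have hsd : (F₂ \ F₁).card + (F₂ ∩ F₁).card = F₂.card := Finset.card_sdiff_add_card_inter _ _
  have hwu : wsum w (F₂ ∪ F₁) = wsum w F₁ + wsum w (F₂ \ F₁) := by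
    rw [Finset.union_comm]; exact (wsum_union_ge w _ _).symm
  have hrank : lineRank [F₂, F₁] = 3 := by
    simp only [unionL, lineRank, Finset.union_empty, Finset.sdiff_empty, Finset.inter_empty, Finset.card_empty,
      Nat.zero_add]
    rw [show (2 - min 0 2 : ℕ) = 2 by decide, ci2]
    have : min F₁.card 2 = 2 := min_eq_right (by omega)
    omega
  have hwb : wsum w (unionL [F₂, F₁]) = 6 := by
    simp only [unionL, Finset.union_empty]
    omega
  have hb : ([F₂, F₁] : List (Finset β)).Nodup := by simp [h21]
  have hbl : ∀ L ∈ ([F₂, F₁] : List (Finset β)), L ∈ ls := by simp [hF₁, hF₂]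
  have hD := card_filter_disjoint_le_four_gen h1 h2 h3 h4 hb hbl (by rw [hrank, hwb])
  have hcover : ls ⊆ ({F₂, F₁} : Finset (Finset β)) ∪ ls.filter (fun L => Disjoint L (unionL [F₂, F₁])) := by
    intro Y hY
    rw [Finset.mem_union, Finset.mem_insert, Finset.mem_singleton]
    by_cases hY2 : Y = F₂
    · exact Or.inl (Or.inl hY2)
    by_cases hY1 : Y = F₁
    · exact Or.inl (Or.inr hY1)
    refine Or.inr (Finset.mem_filter.2 ⟨hY, ?_⟩)
    rw [Finset.disjoint_iff_inter_eq_empty]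
    by_contra hne
    obtain ⟨hcY, hwY⟩ := hoth Y hY hY1 hY2
    have ho : (Y ∩ unionL [F₂, F₁]).card ≤ 2 := by
      simp only [unionL, Finset.union_empty]
      rw [Finset.inter_union_distrib_left]
      refine (Finset.card_union_le _ _).trans ?_
      have := h3 Y hY F₂ hF₂ hY2
      have := h3 Y hY F₁ hF₁ hY1
      omega
    exact not_meet_of_cost_three h1 h7 hb hbl hrank hwb hY (by simp [hY1, hY2]) hcY hwY
      (Finset.nonempty_iff_ne_empty.2 hne) ho
  have hc := Finset.card_le_card hcover
  have hu := Finset.card_union_le ({F₂, F₁} : Finset (Finset β)) (ls.filter (fun L => Disjoint L (unionL [F₂, F₁])))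
  have h2' : ({F₂, F₁} : Finset (Finset β)).card ≤ 2 := Finset.card_le_two
  omega

end SixHeavy

end FourCap

end S1

end PercRepro
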